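import Summits.CriticalPhenomena.PercolationContinuityZ3.Theorems.Transplant.GrigorchukPowerLaceOperators
import Summits.CriticalPhenomena.PercolationContinuityZ3.Theorems.Transplant.GrigorchukPowerBootstrapContinuous
import Summits.CriticalPhenomena.PercolationContinuityZ3.Theorems.Transplant.GrigorchukPowerTraceMonotonicity
import Summits.CriticalPhenomena.PercolationContinuityZ3.Theorems.Transplant.GrigorchukPowerNcHaraSladeLaceNormLemmas
import HarnessLib

/-!
# W4 S3b-α «LaceOperators» (second file): the two-point operator `T = ρ(τ_p)`, the DICTIONARY lemmas `⟪f, T f⟫ = twoPointForm`, `⟪f, P_L^n f⟫ = Σ f f lazyStep n`,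
# `greenForm = Σ_n ofReal ⟪f, P_L^n f⟫`, and the OPERATOR RENEWAL IDENTITY `T = ρ(Ψ) + p · ρ(Ψ) A T` of a lace kernel

Definition + proof file (`--kind definition`, `--supports stmt-CriticalPhenomena-4575 --as helper`), lane `prim-bschramm`, seat `prim-bschramm-gen-1` gen 13 (GEN pen);
item α of the director's S3b WORD (#10178) / lead :588, design text P3-NILPOTENT §38 — this is α₂ = (d6) `twoPointOp` with `conn_gkCay_eq_tauFun` (left invariance),
`tauFun_inv` (symmetry), `‖T‖ ≤ χ`, `T† = T`; (L1) `inner_toL2_twoPointOp`; (L2) `lazyOp_pow_toL2_apply` / `inner_toL2_lazyOp_pow` / `greenForm_eq_tsum_inner`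
(`lazyStep n` IS the matrix of `P_L^n` on `Cay(𝔊^k; std)`, `k ≥ 1`); (L5) `twoPointOp_eq_renewal` — DEFS-C's `IsLaceKernel` identity `τ = Ψ + p·Ψ⋆𝟙_S⋆τ` pushed
through `kernelOp` (linear and multiplicative, α₁ `kernelOp_mul`).  Serves S3b′ `stub_fBoot_le_of_laceBound` (v1.8 :80) via P3-NILPOTENT §37.2 (orientation
(37.1)); ASSERTS NOTHING about it — no inverse, no Neumann series, no `laceBound`, no OIRB.  builds on p205010 (kernel theorem, internal audit signed; external expert
review pending) — nothing here uses p205010.  No instance, no notation, no sorry.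
[cite: HeydenreichVanDerHofstad2017, §1.2 (infrared bound as a quadratic form), §5.2 (random-walk quantities), §6.2 (the expansion identity)] [cite: HaraSlade1990, §4]
-/

noncomputable section

namespace Summit.CriticalPhenomena.PercolationContinuityZ3.Theorems.Transplant

namespace Grigorchuk

namespace NcHaraSlade

open SimpleGraph Literature.Probability.Percolation
open scoped ENNReal Classical InnerProductSpace

variable {k : ℕ}

/-! ## §1 (d6) The two-point operator `T = ρ(τ_p)` -/

/-- Left multiplication by `c` is an automorphism of `Cay(𝔊^k; std)` (right Cayley graph). [cite: BenjaminiSchramm1996, §2 (Cayley graphs)] -/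
def mulLeftIso (c : GPow k) : gkCay k ≃g gkCay k := ⟨Equiv.mulLeft c, mulCayley_adj_mul_iff_right⟩

/-- `mulLeftIso c x = c * x`. [folklore] -/
@[simp] theorem mulLeftIso_apply (c x : GPow k) : mulLeftIso c x = c * x := rfl

/-- **Left invariance: `τ_p(x, y) = τ_p(x⁻¹y)`** (`conn (gkCay k) p x y = tauFun k p (x⁻¹ * y)`). [cite: HaraSlade1990, §1 (two-point function)] -/
theorem conn_gkCay_eq_tauFun (p : unitInterval) (x y : GPow k) : conn (gkCay k) p x y = tauFun k p (x⁻¹ * y) := by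
  have h := conn_iso (gkCay k) (mulLeftIso x⁻¹) p x y
  rw [mulLeftIso_apply, mulLeftIso_apply, inv_mul_cancel] at h
  rw [tauFun, h]

/-- **Symmetry: `τ_p(g⁻¹) = τ_p(g)`** (`τ̌ = τ`). [cite: HaraSlade1990, §1] -/
theorem tauFun_inv (p : unitInterval) (g : GPow k) : tauFun k p g⁻¹ = tauFun k p g := by
  have h := conn_gkCay_eq_tauFun p g (1 : GPow k)
  rw [mul_one, conn_comm] at h
  rw [← h, tauFun]

/-- `τ_p ∈ ℓ¹` below `p_c` (`χ < ∞`, DCTQ sharpness via «GrigorchukPowerBootstrapContinuous» `summable_conn_gkCay`). [cite: DuminilCopinTassionCMP2016, Thm. 1.1(2)] -/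
theorem summable_tauFun {p : unitInterval} (hp : (p : ℝ) < pcR k) : Summable (tauFun k p) := summable_conn_gkCay k p hp 1

/-- `|τ_p| ∈ ℓ¹` below `p_c` (the form `kernelOp` lemmas take). [folklore] -/
theorem summable_abs_tauFun {p : unitInterval} (hp : (p : ℝ) < pcR k) : Summable fun g => |tauFun k p g| := by
  simpa only [abs_of_nonneg (tauFun_nonneg _ _)] using summable_tauFun hp

/-- **(d6) `twoPointOp k p = ρ(τ_p)`** — the two-point function as a bounded operator on `ℓ²(𝔊^k)` (meaningful for `p < p_c`). [cite: HeydenreichVanDerHofstad2017, §1.2 (infrared bound)] -/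
def twoPointOp (k : ℕ) (p : unitInterval) : lp (fun _ : GPow k => ℝ) 2 →L[ℝ] lp (fun _ : GPow k => ℝ) 2 := kernelOp (tauFun k p)

/-- `‖T‖ ≤ χ_p = Σ'_g τ_p(g)` below `p_c`. [cite: HeydenreichVanDerHofstad2017, §1.2] -/
theorem norm_twoPointOp_le {p : unitInterval} (hp : (p : ℝ) < pcR k) : ‖twoPointOp k p‖ ≤ ∑' g, tauFun k p g := by
  have h := norm_kernelOp_le (summable_abs_tauFun (k := k) hp)
  simp only [abs_of_nonneg (tauFun_nonneg _ _)] at h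
  exact h

/-- **`T† = T`** below `p_c` (`τ̌ = τ`). [cite: HeydenreichVanDerHofstad2017, §1.2] -/
theorem adjoint_twoPointOp {p : unitInterval} (hp : (p : ℝ) < pcR k) : ContinuousLinearMap.adjoint (twoPointOp k p) = twoPointOp k p := by
  rw [twoPointOp, adjoint_kernelOp (summable_abs_tauFun hp)]
  simp_rw [tauFun_inv]

/-- `(T η)(x) = Σ'_y τ_p(x, y) η(y)` below `p_c`. [cite: HeydenreichVanDerHofstad2017, §1.2] -/
theorem twoPointOp_apply_apply {p : unitInterval} (hp : (p : ℝ) < pcR k) (η : lp (fun _ : GPow k => ℝ) 2) (x : GPow k) :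
    twoPointOp k p η x = ∑' y, conn (gkCay k) p x y * η y := by
  rw [twoPointOp, kernelOp_apply_apply (summable_abs_tauFun hp), ← (Equiv.mulLeft x⁻¹).tsum_eq (fun g => tauFun k p g * η (x * g))]
  refine tsum_congr fun y => ?_
  rw [Equiv.coe_mulLeft, mul_inv_cancel_left, conn_gkCay_eq_tauFun]

/-! ## §2 (L1) `⟪f, T f⟫ = twoPointForm` -/

/-- A coordinate sum against a finitely supported vector is a finite sum. [folklore] -/
theorem tsum_mul_toL2_eq_sum (f : GPow k →₀ ℝ) (F : GPow k → ℝ) : ∑' y, F y * toL2 f y = ∑ y ∈ f.support, F y * f y := by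
  rw [tsum_eq_sum (s := f.support) (fun y hy => by rw [toL2_apply, Finsupp.notMem_support_iff.1 hy, mul_zero])]
  rfl

/-- **(L1) `⟪toL2 f, T (toL2 f)⟫ = twoPointForm (gkCay k) p f`** for finitely supported `f` and `p < p_c` — DEFS-A's quadratic form IS the operator's.
[cite: HeydenreichVanDerHofstad2017, §1.2 (infrared bound as a quadratic form inequality)] -/
theorem inner_toL2_twoPointOp {p : unitInterval} (hp : (p : ℝ) < pcR k) (f : GPow k →₀ ℝ) :
    ⟪toL2 f, twoPointOp k p (toL2 f)⟫_ℝ = twoPointForm (gkCay k) p f := by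
  rw [lp.inner_eq_tsum, twoPointForm]
  have hx : ∀ x, ⟪toL2 f x, twoPointOp k p (toL2 f) x⟫_ℝ = (∑ y ∈ f.support, conn (gkCay k) p x y * f y) * toL2 f x := by
    intro x
    rw [Real.inner_apply, twoPointOp_apply_apply hp, tsum_mul_toL2_eq_sum, mul_comm]
  simp_rw [hx]
  rw [tsum_mul_toL2_eq_sum]
  refine Finset.sum_congr rfl fun x _ => ?_
  rw [Finset.sum_mul]
  exact Finset.sum_congr rfl fun y _ => by ring

/-! ## §3 (L2) `lazyStep n` is the matrix of `P_L^n` -/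

/-- A sum over the neighbours of `x` in `Cay(𝔊^k; std)` is a sum over the generators: `Σ_{z ∼ x} F z = Σ_{s ∈ S_k} F (x s)`. [cite: BenjaminiSchramm1996, §2] -/
theorem sum_neighborFinset_gkCay (F : GPow k → ℝ) (x : GPow k) : ∑ z ∈ (gkCay k).neighborFinset x, F z = ∑ s ∈ gkGens k, F (x * s) := by
  rw [gkCay_neighborFinset, gkGens_eq_image, Finset.sum_image, Finset.sum_image]
  · intro p _ q _ h
    exact mulSingle_toG_injective k h
  · intro p _ q _ h
    exact mulSingle_toG_injective k (mul_left_cancel h)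

/-- `(P_L η)(x) = ½ η(x) + ½ (4k)⁻¹ Σ_{s ∈ S_k} η(x s)`. [cite: HeydenreichVanDerHofstad2017, §5.2] -/
theorem lazyOp_apply_apply (η : lp (fun _ : GPow k => ℝ) 2) (x : GPow k) :
    lazyOp k η x = (1 / 2 : ℝ) * η x + (1 / 2 : ℝ) * ((1 / (4 * (k : ℝ))) * ∑ s ∈ gkGens k, η (x * s)) := by
  simp only [lazyOp, srwOp, FunLike.coe_smul, Pi.smul_apply, add_apply, one_apply_eq_self, lp.coeFn_add, Pi.add_apply, lp.coeFn_smul,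
    adjOp_apply_apply, smul_eq_mul]
  ring

/-- **`(P_L^n (toL2 f))(x) = Σ_{y ∈ supp f} lazyStep n x y · f y`** (every `k`; for `k = 0` both sides read `1/0 = 0`): DEFS-A's `lazyStep` recursion is `P_L^{n+1} = P_L P_L^n` read in coordinates (neighbours
of `x` = `{x s}`, degree `4k`). [cite: HeydenreichVanDerHofstad2017, §5.2] -/
theorem lazyOp_pow_toL2_apply (n : ℕ) (f : GPow k →₀ ℝ) (x : GPow k) :
    (lazyOp k ^ n) (toL2 f) x = ∑ y ∈ f.support, lazyStep (gkCay k) n x y * f y := by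
  induction n generalizing x with
  | zero =>
    rw [pow_zero, one_apply_eq_self, toL2_apply]
    simp only [lazyStep_zero, ite_mul, one_mul, zero_mul, Finset.sum_ite_eq, Finsupp.mem_support_iff, ne_eq, ite_not]
    by_cases h : f x = 0
    · simp [h]
    · simp [h]
  | succ n ih =>
    rw [pow_succ', mul_apply_eq_comp, lazyOp_apply_apply, ih]
    simp_rw [ih]
    have hdeg : ((gkCay k).degree x : ℝ) = 4 * k := by rw [gkCay_degree]; push_cast; ring
    simp_rw [lazyStep_succ, sum_neighborFinset_gkCay, hdeg]
    simp_rw [Finset.mul_sum]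
    rw [Finset.sum_comm, ← Finset.sum_add_distrib]
    refine Finset.sum_congr rfl fun y _ => ?_
    rw [add_mul, Finset.sum_mul]
    congr 1
    · ring
    · exact Finset.sum_congr rfl fun s _ => by ring

/-- **(L2) `⟪toL2 f, P_L^n (toL2 f)⟫ = Σ_{x,y ∈ supp f} f x f y lazyStep n x y`**. [cite: HeydenreichVanDerHofstad2017, §5.2] -/
theorem inner_toL2_lazyOp_pow (n : ℕ) (f : GPow k →₀ ℝ) :
    ⟪toL2 f, (lazyOp k ^ n) (toL2 f)⟫_ℝ = ∑ x ∈ f.support, ∑ y ∈ f.support, f x * f y * lazyStep (gkCay k) n x y := by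
  rw [lp.inner_eq_tsum]
  have hx : ∀ x, ⟪toL2 f x, (lazyOp k ^ n) (toL2 f) x⟫_ℝ = (∑ y ∈ f.support, lazyStep (gkCay k) n x y * f y) * toL2 f x := by
    intro x
    rw [Real.inner_apply, lazyOp_pow_toL2_apply, mul_comm]
  simp_rw [hx]
  rw [tsum_mul_toL2_eq_sum]
  refine Finset.sum_congr rfl fun x _ => ?_
  rw [Finset.sum_mul]
  exact Finset.sum_congr rfl fun y _ => by ring

/-- **COROLLARY: `greenForm (gkCay k) f = Σ'_n ofReal ⟪toL2 f, P_L^n (toL2 f)⟫`**, every summand `≥ 0` (for `k ≥ 1`) by α₁ `inner_lazyOp_pow_nonneg`.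
[cite: HeydenreichVanDerHofstad2017, §1.2 and §5.2 (the Green form)] -/
theorem greenForm_eq_tsum_inner (f : GPow k →₀ ℝ) :
    greenForm (gkCay k) f = ∑' n : ℕ, ENNReal.ofReal ⟪toL2 f, (lazyOp k ^ n) (toL2 f)⟫_ℝ := by
  unfold greenForm
  exact tsum_congr fun n => by rw [inner_toL2_lazyOp_pow]

/-! ## §4 (L5) The operator renewal identity of a lace kernel -/

/-- `(a ⋆ b) ∈ ℓ¹` for `a, b ∈ ℓ¹` (DEFS-C's convolution, inlined): `m ↦ Σ'_g a(g) b(g⁻¹m)` is absolutely summable. [folklore] -/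
theorem summable_abs_conv {a b : GPow k → ℝ} (ha : Summable fun g => |a g|) (hb : Summable fun g => |b g|) :
    Summable fun m => |∑' g, a g * b (g⁻¹ * m)| := by
  have ha' : Summable fun g => ‖a g‖ := by simpa only [Real.norm_eq_abs] using ha
  have hb' : Summable fun g => ‖b g‖ := by simpa only [Real.norm_eq_abs] using hb
  set e : GPow k × GPow k ≃ GPow k × GPow k :=
    ⟨fun z => (z.1 * z.2, z.1), fun q => (q.2, q.2⁻¹ * q.1), fun z => by simp, fun q => by simp⟩ with he
  set Φ : GPow k × GPow k → ℝ := fun q => |a q.2| * |b (q.2⁻¹ * q.1)| with hΦ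
  have hΦs : Summable Φ := by
    have h := ha'.mul_norm hb'
    refine e.summable_iff.1 ?_
    convert h using 1
    funext z
    simp [hΦ, he, Real.norm_eq_abs]
  refine (hΦs.prod).of_nonneg_of_le (fun _ => abs_nonneg _) fun m => ?_
  calc |∑' g, a g * b (g⁻¹ * m)| ≤ ∑' g, |a g * b (g⁻¹ * m)| := by
        have hs : Summable fun g => |a g * b (g⁻¹ * m)| := by simpa only [hΦ, abs_mul] using hΦs.prod_factor m
        have hs' : Summable fun g => ‖a g * b (g⁻¹ * m)‖ := by simpa only [Real.norm_eq_abs] using hs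
        have h := norm_tsum_le_tsum_norm hs'
        simpa only [Real.norm_eq_abs] using h
    _ = ∑' g, Φ (m, g) := tsum_congr fun g => by rw [hΦ, abs_mul]

/-- The indicator of the generating set, `𝟙_{S_k}`. [folklore] -/
theorem summable_abs_indicator_gkGens : Summable fun g : GPow k => |(if g ∈ gkGens k then (1 : ℝ) else 0)| :=
  summable_of_ne_finset_zero (s := gkGens k) fun g hg => by simp [hg]

/-- `A = ρ(𝟙_{S_k})`. [folklore] -/
theorem adjOp_eq_kernelOp : adjOp k = kernelOp (fun g => if g ∈ gkGens k then (1 : ℝ) else 0) := by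
  unfold adjOp kernelOp
  rw [tsum_eq_sum (s := gkGens k) (fun g hg => by simp [hg])]
  exact Finset.sum_congr rfl fun s hs => by simp [hs]

/-- `(𝟙_S ⋆ τ)(m) = Σ_{s ∈ S_k} τ((s)⁻¹ m)` — on the finite generating set the convolution is a finite sum. [folklore] -/
theorem conv_indicator_gkGens (b : GPow k → ℝ) (m : GPow k) :
    ∑' g, (if g ∈ gkGens k then (1 : ℝ) else 0) * b (g⁻¹ * m) = ∑ s ∈ gkGens k, b (s⁻¹ * m) := by
  rw [tsum_eq_sum (s := gkGens k) (fun g hg => by simp [hg])]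
  exact Finset.sum_congr rfl fun s hs => by simp [hs]

/-- **(L5) THE OPERATOR RENEWAL IDENTITY** (P3-NILPOTENT (37.1)): if `K` is a lace kernel at `p < p_c` (DEFS-C `IsLaceKernel k p K`), then with `Ψ = δ + K`,
`T = ρ(Ψ) + p · ρ(Ψ) A T` as bounded operators on `ℓ²(𝔊^k)` — the ℓ¹-function identity `τ = Ψ + p·Ψ ⋆ (𝟙_S ⋆ τ)` of `IsLaceKernel.renewal` pushed through the
linear multiplicative `kernelOp` (α₁ `kernelOp_mul`, `adjOp = ρ(𝟙_S)`).  Nothing asserts that a lace kernel exists. [cite: HeydenreichVanDerHofstad2017, §6.2 (the expansion identity)] [cite: HaraSlade1990, §4] -/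
theorem twoPointOp_eq_renewal {p : unitInterval} {K : GPow k → ℝ} (hK : IsLaceKernel k p K) (hp : (p : ℝ) < pcR k) :
    twoPointOp k p = kernelOp (fun g => deltaFun k g + K g) +
      (p : ℝ) • (kernelOp (fun g => deltaFun k g + K g) * adjOp k * twoPointOp k p) := by
  have hδ : Summable fun g : GPow k => |deltaFun k g| := summable_of_ne_finset_zero (s := {1}) fun g hg => by
    rw [Finset.mem_singleton] at hg; rw [deltaFun_of_ne_one hg, abs_zero]
  have hΨ : Summable fun g => |deltaFun k g + K g| :=
    (hδ.add hK.summable_abs).of_nonneg_of_le (fun _ => abs_nonneg _) fun g => abs_add_le _ _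
  have hτ := summable_abs_tauFun (k := k) hp
  have h1 := summable_abs_indicator_gkGens (k := k)
  -- the convolution `C = Ψ ⋆ (𝟙_S ⋆ τ)` as a function (kept opaque: no higher-order unification against its body)
  obtain ⟨C, hC⟩ : ∃ C : GPow k → ℝ, C = fun g => ∑' x, (deltaFun k x + K x) * ∑ s ∈ gkGens k, tauFun k p (s⁻¹ * (x⁻¹ * g)) :=
    ⟨_, rfl⟩
  -- `A T = ρ(𝟙_S ⋆ τ)` and `ρ(Ψ) (A T) = ρ(C)`
  have hAT : adjOp k * twoPointOp k p = kernelOp (fun m => ∑ s ∈ gkGens k, tauFun k p (s⁻¹ * m)) := by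
    rw [adjOp_eq_kernelOp, twoPointOp, kernelOp_mul h1 hτ]
    simp_rw [conv_indicator_gkGens]
  have hSτ : Summable fun m => |∑ s ∈ gkGens k, tauFun k p (s⁻¹ * m)| := by
    have h := summable_abs_conv h1 hτ
    simp_rw [conv_indicator_gkGens] at h
    exact h
  have hprod : kernelOp (fun g => deltaFun k g + K g) * adjOp k * twoPointOp k p = kernelOp C := by
    rw [mul_assoc, hAT, kernelOp_mul hΨ hSτ, hC]
  have hconv' := summable_abs_conv hΨ hSτ
  have hconv : Summable fun g => |C g| := by rw [hC]; exact hconv'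
  have hpC : Summable fun g => |(p : ℝ) * C g| := by simpa only [abs_mul, abs_of_nonneg p.2.1] using hconv.mul_left |(p : ℝ)|
  -- the ℓ¹-function identity, from `IsLaceKernel.renewal`
  have hfun : tauFun k p = fun g => (deltaFun k g + K g) + (p : ℝ) * C g := by
    funext g
    rw [hK.renewal g, hC]
    have hx : ∀ x : GPow k, ∑ s ∈ gkGens k, tauFun k p ((x * s)⁻¹ * g) = ∑ s ∈ gkGens k, tauFun k p (s⁻¹ * (x⁻¹ * g)) :=
      fun x => Finset.sum_congr rfl fun s _ => by rw [mul_inv_rev, mul_assoc]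
    simp_rw [hx]
  calc twoPointOp k p = kernelOp (tauFun k p) := rfl
    _ = kernelOp (fun g => (deltaFun k g + K g) + (p : ℝ) * C g) := by rw [hfun]
    _ = kernelOp (fun g => deltaFun k g + K g) + kernelOp (fun g => (p : ℝ) * C g) := kernelOp_add hΨ hpC
    _ = kernelOp (fun g => deltaFun k g + K g) + (p : ℝ) • kernelOp C := by rw [kernelOp_const_mul hconv]
    _ = _ := by rw [hprod]

end NcHaraSlade

end Grigorchuk

end Summit.CriticalPhenomena.PercolationContinuityZ3.Theorems.Transplant

end
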